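import Summits.ABC.IUTFork.Cor312VolumesRealAssembly
import HarnessLib

/-!
# Test (E-cx-2, currency note for E-LOCATION §L2 ADDENDUM 3): `LogvAnalytic logv` determines `logv`

`Real.LogvAnalyticAt p logv` prescribes `logv v` on every unit at every place `v` with `p ∈ 𝔭_v`; hence the law
`LogvAnalytic logv` (all primes) pins the whole family: `logv = Real.analyticLogv F`.  Consequence: every record stated at
the analytic family `Real.analyticLogv F` (e.g. E-t44 g3's p446217 / p446474 genuine-pins vacuity) transfers by `subst` to the
records quantifying a general `logv` under `hlog : LogvAnalytic logv` (p430714 / p436213 / p438843 / p445249), and conversely.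
PROOF-ONLY, 0 `def`.  No side taken on [IUTchIII] Cor. 3.12 or on any author.
-/

namespace Summit.ABC.IUTFork.Joshi

open IsDedekindDomain NumberField Thm311 Thm311.Real Cor312Vol Literature.IUT.LogVolume

variable {F : Type} [Field F] [NumberField F]

/-- **The analytic-logarithm law is extensional**: a family of `p`-adic logarithms analytic at every prime IS c312-5's
analytic family. [cite: NeukirchANT1999, Ch. II (5.5)] -/
theorem eq_analyticLogv_of_logvAnalytic {logv : PadicLogs F} (hlog : LogvAnalytic (F := F) logv) :
    logv = analyticLogv F := by
  funext v
  haveI : Fact (residueChar F v).Prime := ⟨residueChar_prime F v⟩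
  have h₁ := hlog ⟨residueChar F v, residueChar_prime F v⟩ v (natCast_residueChar_mem F v)
  have h₂ := (logvAnalytic_analyticLogv (F := F)) ⟨residueChar F v, residueChar_prime F v⟩ v (natCast_residueChar_mem F v)
  refine AddMonoidHom.ext fun u' => ?_
  have e₁ := h₁ (Additive.toMul u')
  have e₂ := h₂ (Additive.toMul u')
  rw [ofMul_toMul] at e₁ e₂
  rw [e₁, e₂]

/-- Hence any statement about the family under the law is a statement about the analytic family. [folklore] -/
theorem logvAnalytic_iff_eq_analyticLogv {logv : PadicLogs F} :
    LogvAnalytic (F := F) logv ↔ logv = analyticLogv F :=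
  ⟨eq_analyticLogv_of_logvAnalytic, fun h => h ▸ logvAnalytic_analyticLogv⟩

end Summit.ABC.IUTFork.Joshi
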